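import Literature.NumberTheory.NumberFields.SemilocalPrincipalUnitsPlaces
import HarnessLib

/-!
# The semi-local carrier over a tower `K ⊆ K₀ ⊆ F`: `K_v ⊗_K F ≃ ∏_{w₀∣v} ∏_{w∣w₀} F_w = ∏_{w₀∣v} SemiLocal K₀ F w₀`,
# equivariantly for `Gal(F/K₀)` — so the decomposition groups OVER `K₀` act on the components through
# `Gal(F_w/(K₀)_{w₀})` (proved, no named fact)

Topic `NumberTheory/NumberFields`; namespace `Literature.NumberTheory.NumberFields.Semilocal`; sequel of
`SemilocalPrincipalUnitsPlaces.lean` (the base case `K₀ = K`: `toSemiLocal : K_v ⊗_K F ≃+* SemiLocal K F v`,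
`toSemiLocal_map`, `unitsToSemiLocal`, §5 `toSemiLocal_map_apply_of_mem_stabilizer`). Cell `bsd-print-cf2`, seat
`bsd-print-cf2-ty2` g43 (literature-prover, typer).

WHY. In the cell's local atom (crux stmt-23300, `stub_localAtom`, memo `BRICK-B-LOCALATOM-w5g11.md` §3) the datum
`semilocalUnitData₂` lives on `K_v ⊗_K F_n` over the CM field `K`, but the group acting is `Gal(F_n/K₀)` for the
frame field `K₀ = K_θ` (`[K₀:K] ∣ 2`), and the per-place bound (FILE B) is applied to the local extension
`F_{n,w} / (K₀)_{w₀}`, `w₀ = w ∩ K₀`, whose Galois group is the decomposition group of `w` in `Gal(F_n/K₀)`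
(the tree's `SemiLocal.decompMulEquiv` over BASE `K₀`). This file regroups the places of `F` above `v` by their
restriction to `K₀` and identifies the carrier over `K` with the product over `w₀ ∣ v` of the packet's models over
`K₀`, equivariantly for `σ ∈ Gal(F/K₀)` (acting on `K_v ⊗_K F` as `1 ⊗ σ|_K`):

* §1 `placeUnder K₀ w : v.Extension (𝓞 K₀)` (`w ∩ K₀` for `w ∣ v`) and `placeOver w : SemiLocal.Place K₀ F (w ∩ K₀)`;
* §2 **`toSemiLocalTower : Alg K v F ≃+* Π w₀ : v.Extension (𝓞 K₀), SemiLocal K₀ F w₀.1`** with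
  `toSemiLocalTower_apply` (the `(w₀, w)`-component is `(piEquiv x)_w`);
* §3 **`toSemiLocalTower_map`: `toSemiLocalTower ((1 ⊗ σ|_K) x) w₀ = σ • toSemiLocalTower x w₀`** for
  `σ : F ≃ₐ[K₀] F` (the transport maps of `σ` and of `σ|_K` agree: `galAdicCompletionMap_restrictScalars`);
  hence, for `g` in the decomposition group `Stab_{Gal(F/K₀)}(w)`, **the `(w₀,w)`-component of `(1 ⊗ g|_K) x` is
  `SemiLocal.decompAlgEquiv w g` (`= decompMulEquiv w g ∈ Gal(F_w/(K₀)_{w₀})` for `F/K₀` Galois) of the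
  `(w₀,w)`-component of `x`** (`toSemiLocalTower_map_apply_of_mem_stabilizer`, `…_eq_decompMulEquiv`);
* §4 units: `unitsToSemiLocalTower : (order K v F)ˣ →* Π w₀, (SemiLocal K₀ F w₀.1)ˣ`, components in
  `SemiLocal.unitGroup K₀ F w₀.1`, equivariant, principal units componentwise.
* §5 the SUBGROUP FORM (base field `F^H = IntermediateField.fixedField H` for `H ≤ Gal(F/K)`, the way the cell types
  `Gal(F_n/K₀) ≤ Gal(F_n/K)`): `toSemiLocalTower_map_subgroup` (`σ ∈ H` acts as `subgroupEquivAlgEquiv H σ ∈ Gal(F/F^H)`),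
  `toSemiLocalTower_map_subgroup_apply_of_smul_eq` / `…_eq_decompMulEquiv` (stabilisers act through
  `Gal(F_w/(F^H)_{w₀})`), `unitsToSemiLocalTower_mapUnits_subgroup`.
* §6 the INTERMEDIATE-FIELD FORM (base `K₀ : IntermediateField K F`, group `K₀.fixingSubgroup`, Mathlib
  `IntermediateField.fixingSubgroupEquiv`): `toSemiLocalTower_map_fixingSubgroup`, `…_apply_of_smul_eq` / `…_eq_decompMulEquiv`,
  `unitsToSemiLocalTower_mapUnits_fixingSubgroup`.

PRINT. Cassels–Fröhlich Ch. II §10 (10.2) (`K_v ⊗_K F = ⊕_{w∣v} F_w`, applied to `K ⊆ F` and to `K₀ ⊆ F`: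
`w ∣ v` iff `w ∣ w₀` for a (unique) `w₀ ∣ v`), Ch. VII (Tate) §1.1 (`σ_w` for `σ ∈ G`, `G_w` = the Galois group
of `L_w/K_v` — here over the base `K₀`). No named fact, no `sorry`, no instance, no notation. HONEST FRAMING:
dictionary only; no summit statement is proved; BSD is not advanced here.

## References
* [CasselsFrohlichANT1967] J. W. S. Cassels, A. Fröhlich (eds.), *Algebraic Number Theory* (1967), Ch. II §10
  (10.2); Ch. VII §1.1.
* [Harari2020] D. Harari, *Galois Cohomology and Class Field Theory* (2020), §13.1.
-/

noncomputable section

open scoped TensorProduct Pointwise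
open NumberField IsDedekindDomain Field
open Literature.NumberTheory.GaloisRepresentations Literature.NumberTheory.Automorphic
  Literature.NumberTheory.AdelicBaseChange

namespace Literature.NumberTheory.NumberFields.Semilocal

universe u

section Tower

variable (K : Type u) [Field K] [NumberField K] (v : HeightOneSpectrum (𝓞 K))
  (K₀ : Type u) [Field K₀] [NumberField K₀] [Algebra K K₀]
  (F : Type u) [Field F] [NumberField F] [Algebra K F] [Algebra K₀ F] [IsScalarTower K K₀ F]
  [FiniteDimensional K F]

/-! ### §1. Places of `F` above `v`, grouped by their restriction to `K₀` -/

omit [NumberField K] [NumberField K₀] [NumberField F] [FiniteDimensional K F] in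
/-- `(w ∩ K₀) ∩ K = w ∩ K` (places in the tower). [cite: CasselsFrohlichANT1967, Ch. VII §1.1] -/
theorem under_under_eq (w : HeightOneSpectrum (𝓞 F)) : (w.under (𝓞 K₀)).under (𝓞 K) = w.under (𝓞 K) :=
  HeightOneSpectrum.ext (Ideal.under_under (A := 𝓞 K) (B := 𝓞 K₀) w.asIdeal)

omit [FiniteDimensional K F] in
/-- The place `w ∩ K₀` of `K₀` below `w ∣ v`; it lies over `v`. [cite: CasselsFrohlichANT1967, Ch. VII §1.1] -/
def placeUnder (w : v.Extension (𝓞 F)) : v.Extension (𝓞 K₀) :=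
  ⟨w.1.under (𝓞 K₀), by rw [under_under_eq]; exact w.2⟩

omit [FiniteDimensional K F] in
/-- Unfolding `placeUnder`. [cite: CasselsFrohlichANT1967, Ch. VII §1.1] -/
@[simp] theorem placeUnder_val (w : v.Extension (𝓞 F)) : (placeUnder K v K₀ F w).1 = w.1.under (𝓞 K₀) := rfl

omit [FiniteDimensional K F] in
/-- `w` as a place of `F` above `w ∩ K₀`, in the packet's index `SemiLocal.Place K₀ F (w ∩ K₀)`.
[cite: CasselsFrohlichANT1967, Ch. VII §1.1] -/
def placeOver (w : v.Extension (𝓞 F)) : SemiLocal.Place K₀ F (placeUnder K v K₀ F w).1 := ⟨w.1, rfl⟩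

omit [FiniteDimensional K F] in
/-- Unfolding `placeOver`: the underlying place is `w`. [cite: CasselsFrohlichANT1967, Ch. VII §1.1] -/
@[simp] theorem coe_placeOver (w : v.Extension (𝓞 F)) :
    ((placeOver K v K₀ F w : SemiLocal.Place K₀ F (placeUnder K v K₀ F w).1) : HeightOneSpectrum (𝓞 F)) = w.1 := rfl

omit [FiniteDimensional K F] in
/-- A place of `F` above `w₀ ∣ v` (packet index over `K₀`) as an FLT place above `v`. [cite: CasselsFrohlichANT1967, Ch. VII §1.1] -/
def extensionOfPlace (w₀ : v.Extension (𝓞 K₀)) (w : SemiLocal.Place K₀ F w₀.1) : v.Extension (𝓞 F) :=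
  ⟨(w : HeightOneSpectrum (𝓞 F)), by rw [← under_under_eq K K₀ F, w.under_eq]; exact w₀.2⟩

omit [FiniteDimensional K F] in
/-- Unfolding `extensionOfPlace`. [cite: CasselsFrohlichANT1967, Ch. VII §1.1] -/
@[simp] theorem extensionOfPlace_val (w₀ : v.Extension (𝓞 K₀)) (w : SemiLocal.Place K₀ F w₀.1) :
    (extensionOfPlace K v K₀ F w₀ w).1 = (w : HeightOneSpectrum (𝓞 F)) := rfl

/-! ### §2. `K_v ⊗_K F ≃+* ∏_{w₀∣v} ∏_{w∣w₀} F_w` -/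

/-- **`toSemiLocalTower : K_v ⊗_K F ≃+* ∏_{w₀∣v} SemiLocal K₀ F w₀`**: the `(w₀, w)`-component (`w ∣ w₀ ∣ v`) is
`(piEquiv x)_w` — Cassels (10.2) for `K ⊆ F`, the places above `v` grouped by their restriction to `K₀`.
[cite: CasselsFrohlichANT1967, Ch. II §10 (10.2)] -/
def toSemiLocalTower : Alg K v F ≃+* Π w₀ : v.Extension (𝓞 K₀), SemiLocal K₀ F w₀.1 where
  toFun x w₀ w := piEquiv K v F x (extensionOfPlace K v K₀ F w₀ w)
  invFun y := (piEquiv K v F).symm fun w ↦ y (placeUnder K v K₀ F w) (placeOver K v K₀ F w)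
  left_inv x := by
    change (piEquiv K v F).symm (fun w ↦ piEquiv K v F x _) = x
    exact (piEquiv K v F).symm_apply_apply x
  right_inv y := by
    funext w₀ w
    -- `(placeUnder w, placeOver w) = (w₀, w)` after destructuring `w ∩ K₀ = w₀`
    obtain ⟨u, hu⟩ := w₀
    obtain ⟨w', hw'⟩ := w
    change w'.under (𝓞 K₀) = u at hw'
    subst hw'
    exact congrFun ((piEquiv K v F).apply_symm_apply _) _
  map_mul' x y := by
    funext w₀ w
    change piEquiv K v F (x * y) _ = piEquiv K v F x _ * piEquiv K v F y _
    rw [map_mul, Pi.mul_apply]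
  map_add' x y := by
    funext w₀ w
    change piEquiv K v F (x + y) _ = piEquiv K v F x _ + piEquiv K v F y _
    rw [map_add, Pi.add_apply]

/-- Components of `toSemiLocalTower`. [cite: CasselsFrohlichANT1967, Ch. II §10 (10.2)] -/
theorem toSemiLocalTower_apply (x : Alg K v F) (w₀ : v.Extension (𝓞 K₀)) (w : SemiLocal.Place K₀ F w₀.1) :
    toSemiLocalTower K v K₀ F x w₀ w = piEquiv K v F x (extensionOfPlace K v K₀ F w₀ w) := rfl

/-- `toSemiLocalTower` at `(w ∩ K₀, w)` is `(piEquiv x)_w`. [cite: CasselsFrohlichANT1967, Ch. II §10 (10.2)] -/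
@[simp] theorem toSemiLocalTower_apply_placeOver (x : Alg K v F) (w : v.Extension (𝓞 F)) :
    toSemiLocalTower K v K₀ F x (placeUnder K v K₀ F w) (placeOver K v K₀ F w) = piEquiv K v F x w := rfl

/-- `toSemiLocalTower` and the base-`K` model `toSemiLocal`: the `(w₀,w)`-component is the `w`-component.
[cite: CasselsFrohlichANT1967, Ch. II §10 (10.2)] -/
theorem toSemiLocalTower_apply_eq_toSemiLocal (x : Alg K v F) (w₀ : v.Extension (𝓞 K₀)) (w : SemiLocal.Place K₀ F w₀.1) :
    toSemiLocalTower K v K₀ F x w₀ w =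
      toSemiLocal K v F x (extensionEquivPlace K v F (extensionOfPlace K v K₀ F w₀ w)) := rfl

/-- The diagonal: the `(w₀, ·)`-components of `1 ⊗ y` are `SemiLocal.diag K₀ F w₀ y`. [cite: CasselsFrohlichANT1967, Ch. II §10 (10.2)] -/
@[simp] theorem toSemiLocalTower_ofField (y : F) (w₀ : v.Extension (𝓞 K₀)) :
    toSemiLocalTower K v K₀ F (ofField K v F y) w₀ = SemiLocal.diag K₀ F w₀.1 y := by
  funext w
  rw [toSemiLocalTower_apply, piEquiv_ofField]
  rfl

/-! ### §3. `Gal(F/K₀)`-equivariance and the decomposition groups over `K₀` -/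

omit [NumberField K] [NumberField K₀] [NumberField F] [FiniteDimensional K F] in
/-- `σ|_K` and `σ` move the places of `F` identically (`σ : F ≃ₐ[K₀] F`; Tate's action of `G` on the primes of `L`).
[cite: CasselsFrohlichANT1967, Ch. VII §1.1] -/
theorem restrictScalars_smul_place (σ : F ≃ₐ[K₀] F) (w : HeightOneSpectrum (𝓞 F)) :
    (σ.restrictScalars K : F ≃ₐ[K] F) • w = σ • w := by
  apply HeightOneSpectrum.ext
  change Ideal.map (MulSemiringAction.toRingHom (F ≃ₐ[K] F) (𝓞 F) (σ.restrictScalars K)) w.asIdeal =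
    Ideal.map (MulSemiringAction.toRingHom (F ≃ₐ[K₀] F) (𝓞 F) σ) w.asIdeal
  congr 1

omit [NumberField K] [NumberField K₀] [FiniteDimensional K F] in
/-- **The transport of completions along `σ|_K` is the transport along `σ`** (`σ : F ≃ₐ[K₀] F`; both are the
continuous extension of `σ` to `F_w → F_{σw}`). [cite: CasselsFrohlichANT1967, Ch. VII §1.1] -/
theorem galAdicCompletionMap_restrictScalars (σ : F ≃ₐ[K₀] F) {w w' : HeightOneSpectrum (𝓞 F)}
    (h : (σ.restrictScalars K : F ≃ₐ[K] F) • w = w') (h' : σ • w = w') (y : w.adicCompletion F) :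
    galAdicCompletionMap (σ.restrictScalars K : F ≃ₐ[K] F) h y = galAdicCompletionMap σ h' y := by
  refine congrFun (HeightOneSpectrum.adicCompletion.ext_of_coe F w
    (continuous_galAdicCompletionMap F _ h) (continuous_galAdicCompletionMap F _ h') fun x ↦ ?_) y
  rw [galAdicCompletionMap_coe_algEquiv K _ h x, galAdicCompletionMap_coe_algEquiv K₀ σ h' x]
  rfl

/-- **`toSemiLocalTower ((1 ⊗ σ|_K) x) w₀ = σ • toSemiLocalTower x w₀`** for `σ ∈ Gal(F/K₀)`: the Galois action
over `K₀` on the carrier over `K` is, block by block (`w₀ ∣ v`), the packet's action of `Gal(F/K₀)` on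
`SemiLocal K₀ F w₀ = ∏_{w∣w₀} F_w`. [cite: CasselsFrohlichANT1967, Ch. VII §1.1] [cite: Harari2020, §13.1] -/
theorem toSemiLocalTower_map (σ : F ≃ₐ[K₀] F) (x : Alg K v F) (w₀ : v.Extension (𝓞 K₀)) :
    toSemiLocalTower K v K₀ F (map K v ((σ.restrictScalars K : F ≃ₐ[K] F) : F →ₐ[K] F) x) w₀ =
      σ • toSemiLocalTower K v K₀ F x w₀ := by
  funext w
  rw [SemiLocal.smul_apply, toSemiLocalTower_apply_eq_toSemiLocal, toSemiLocalTower_apply_eq_toSemiLocal,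
    toSemiLocal_map_apply]
  -- both sides are transports of the same component along `σ|_K`, resp. `σ`
  have hσw : (σ.restrictScalars K : F ≃ₐ[K] F)⁻¹ • (extensionEquivPlace K v F (extensionOfPlace K v K₀ F w₀ w)) =
      extensionEquivPlace K v F (extensionOfPlace K v K₀ F w₀ (σ⁻¹ • w)) := by
    apply SemiLocal.Place.ext
    change (σ.restrictScalars K : F ≃ₐ[K] F)⁻¹ • (w : HeightOneSpectrum (𝓞 F)) =
      ((σ⁻¹ • w : SemiLocal.Place K₀ F w₀.1) : HeightOneSpectrum (𝓞 F))
    rw [SemiLocal.Place.coe_smul, ← restrictScalars_smul_place K K₀ F σ⁻¹]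
    rfl
  rw [SemiLocal.galAdicCompletionMap_congr_place hσw _
    (by rw [restrictScalars_smul_place]; exact SemiLocal.Place.smul_coe_inv_smul σ w) _]
  exact galAdicCompletionMap_restrictScalars K K₀ F σ _ _ _

/-- Componentwise: `toSemiLocalTower ((1 ⊗ σ|_K) x) w₀ (σ • w) = σ_w (toSemiLocalTower x w₀ w)`. [cite: CasselsFrohlichANT1967, Ch. VII §1.1] -/
theorem toSemiLocalTower_map_apply_smul (σ : F ≃ₐ[K₀] F) (x : Alg K v F) (w₀ : v.Extension (𝓞 K₀))
    (w : SemiLocal.Place K₀ F w₀.1) :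
    toSemiLocalTower K v K₀ F (map K v ((σ.restrictScalars K : F ≃ₐ[K] F) : F →ₐ[K] F) x) w₀ (σ • w) =
      galAdicCompletionMap σ (SemiLocal.Place.smul_coe σ w) (toSemiLocalTower K v K₀ F x w₀ w) := by
  rw [toSemiLocalTower_map, SemiLocal.smul_apply_smul]

/-- The inverse direction: `toSemiLocalTower⁻¹ (fun w₀ ↦ σ • y w₀) = (1 ⊗ σ|_K) (toSemiLocalTower⁻¹ y)`. [cite: CasselsFrohlichANT1967, Ch. VII §1.1] -/
theorem toSemiLocalTower_symm_smul (σ : F ≃ₐ[K₀] F) (y : Π w₀ : v.Extension (𝓞 K₀), SemiLocal K₀ F w₀.1) :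
    (toSemiLocalTower K v K₀ F).symm (fun w₀ ↦ σ • y w₀) =
      map K v ((σ.restrictScalars K : F ≃ₐ[K] F) : F →ₐ[K] F) ((toSemiLocalTower K v K₀ F).symm y) := by
  apply (toSemiLocalTower K v K₀ F).injective
  rw [RingEquiv.apply_symm_apply]
  funext w₀
  rw [toSemiLocalTower_map, RingEquiv.apply_symm_apply]

end Tower

/-! ### §3b. The decomposition groups OVER `K₀` act on the components through `Gal(F_w/(K₀)_{w₀})` -/

section Decomposition

variable (K : Type) [Field K] [NumberField K] (v : HeightOneSpectrum (𝓞 K))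
  (K₀ : Type) [Field K₀] [NumberField K₀] [Algebra K K₀]
  (F : Type) [Field F] [NumberField F] [Algebra K F] [Algebra K₀ F] [IsScalarTower K K₀ F]
  [FiniteDimensional K F]

/-- **For `g ∈ Stab_{Gal(F/K₀)}(w)` the `(w₀,w)`-component of `(1 ⊗ g|_K) x` is `SemiLocal.decompAlgEquiv w g` — an
automorphism of `F_w` over `(K₀)_{w₀}` — of the `(w₀,w)`-component of `x`.** [cite: CasselsFrohlichANT1967, Ch. VII §1.1] -/
theorem toSemiLocalTower_map_apply_of_mem_stabilizer (w₀ : v.Extension (𝓞 K₀)) (w : SemiLocal.Place K₀ F w₀.1)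
    (g : MulAction.stabilizer (F ≃ₐ[K₀] F) w) (x : Alg K v F) :
    toSemiLocalTower K v K₀ F (map K v (((g : F ≃ₐ[K₀] F).restrictScalars K : F ≃ₐ[K] F) : F →ₐ[K] F) x) w₀ w =
      SemiLocal.decompAlgEquiv w g (toSemiLocalTower K v K₀ F x w₀ w) := by
  have hw : (g : F ≃ₐ[K₀] F) • w = w := MulAction.mem_stabilizer_iff.mp g.2
  rw [toSemiLocalTower_map, SemiLocal.smul_apply, SemiLocal.decompAlgEquiv_apply]
  exact SemiLocal.galAdicCompletionMap_congr_place (by rw [inv_smul_eq_iff, hw]) _ _ _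

/-- **For `F/K₀` Galois: the `(w₀,w)`-component of `(1 ⊗ g|_K) x`, `g ∈ Stab_{Gal(F/K₀)}(w)`, is `decompMulEquiv w g` of the
component** — `Stab_{Gal(F/K₀)}(w) ≃* Gal(F_w/(K₀)_{w₀})` (`SemiLocal.decompMulEquiv` over base `K₀`): the decomposition
group over `K₀` acts on the `w`-component of the carrier over `K` through the local Galois group over `(K₀)_{w₀}`.
[cite: CasselsFrohlichANT1967, Ch. VII §1.1] -/
theorem toSemiLocalTower_map_apply_eq_decompMulEquiv [IsGalois K₀ F] (w₀ : v.Extension (𝓞 K₀))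
    (w : SemiLocal.Place K₀ F w₀.1) (g : MulAction.stabilizer (F ≃ₐ[K₀] F) w) (x : Alg K v F) :
    toSemiLocalTower K v K₀ F (map K v (((g : F ≃ₐ[K₀] F).restrictScalars K : F ≃ₐ[K] F) : F →ₐ[K] F) x) w₀ w =
      SemiLocal.decompMulEquiv w g (toSemiLocalTower K v K₀ F x w₀ w) := by
  rw [SemiLocal.decompMulEquiv_apply, toSemiLocalTower_map_apply_of_mem_stabilizer]

/-- Every `(K₀)_{w₀}`-automorphism of `F_w` is the `(w₀,w)`-component of some `1 ⊗ g|_K`, `g ∈ Stab_{Gal(F/K₀)}(w)`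
(`F/K₀` Galois). [cite: CasselsFrohlichANT1967, Ch. VII §1.1] -/
theorem exists_stabilizer_toSemiLocalTower_map_apply_eq [IsGalois K₀ F] (w₀ : v.Extension (𝓞 K₀))
    (w : SemiLocal.Place K₀ F w₀.1)
    (τ : (w : HeightOneSpectrum (𝓞 F)).adicCompletion F ≃ₐ[w₀.1.adicCompletion K₀] (w : HeightOneSpectrum (𝓞 F)).adicCompletion F) :
    ∃ g : MulAction.stabilizer (F ≃ₐ[K₀] F) w, ∀ x : Alg K v F,
      toSemiLocalTower K v K₀ F (map K v (((g : F ≃ₐ[K₀] F).restrictScalars K : F ≃ₐ[K] F) : F →ₐ[K] F) x) w₀ w =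
        τ (toSemiLocalTower K v K₀ F x w₀ w) := by
  obtain ⟨g, hg⟩ := (SemiLocal.decompMulEquiv w).surjective τ
  exact ⟨g, fun x ↦ by rw [toSemiLocalTower_map_apply_eq_decompMulEquiv, hg]⟩

end Decomposition

/-! ### §4. Units, block by block -/

section Units

variable (K : Type u) [Field K] [NumberField K] (v : HeightOneSpectrum (𝓞 K))
  (K₀ : Type u) [Field K₀] [NumberField K₀] [Algebra K K₀]
  (F : Type u) [Field F] [NumberField F] [Algebra K F] [Algebra K₀ F] [IsScalarTower K K₀ F]
  [FiniteDimensional K F]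

/-- **Local units block by block**: `(order)ˣ →* ∏_{w₀∣v} (SemiLocal K₀ F w₀)ˣ`, `u ↦ toSemiLocalTower u`.
[cite: CasselsFrohlichANT1967, Ch. II §10 (10.2)] -/
def unitsToSemiLocalTower : (order K v F)ˣ →* Π w₀ : v.Extension (𝓞 K₀), (SemiLocal K₀ F w₀.1)ˣ :=
  (MulEquiv.piUnits.toMonoidHom.comp (Units.map (toSemiLocalTower K v K₀ F).toRingHom.toMonoidHom)).comp
    (Units.map (order K v F).subtype.toMonoidHom)

/-- Unfolding: the `w₀`-block of `unitsToSemiLocalTower u`, as an element of `SemiLocal K₀ F w₀`, is `toSemiLocalTower u w₀`.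
[cite: CasselsFrohlichANT1967, Ch. II §10 (10.2)] -/
@[simp] theorem coe_unitsToSemiLocalTower_apply (u : (order K v F)ˣ) (w₀ : v.Extension (𝓞 K₀)) :
    ((unitsToSemiLocalTower K v K₀ F u w₀ : (SemiLocal K₀ F w₀.1)ˣ) : SemiLocal K₀ F w₀.1) =
      toSemiLocalTower K v K₀ F ((u : order K v F) : Alg K v F) w₀ := rfl

/-- The blocks of `unitsToSemiLocalTower u` and the base-`K` image `unitsToSemiLocal u` have the same components.
[cite: CasselsFrohlichANT1967, Ch. II §10 (10.2)] -/
theorem coe_unitsToSemiLocalTower_apply_apply (u : (order K v F)ˣ) (w₀ : v.Extension (𝓞 K₀)) (w : SemiLocal.Place K₀ F w₀.1) :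
    ((unitsToSemiLocalTower K v K₀ F u w₀ : (SemiLocal K₀ F w₀.1)ˣ) : SemiLocal K₀ F w₀.1) w =
      ((unitsToSemiLocal K v F u : (SemiLocal K F v)ˣ) : SemiLocal K F v)
        (extensionEquivPlace K v F (extensionOfPlace K v K₀ F w₀ w)) := rfl

/-- `unitsToSemiLocalTower` is injective. [cite: CasselsFrohlichANT1967, Ch. II §10 (10.2)] -/
theorem unitsToSemiLocalTower_injective : Function.Injective (unitsToSemiLocalTower K v K₀ F) := by
  intro u u' h
  have h' : toSemiLocalTower K v K₀ F ((u : order K v F) : Alg K v F) =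
      toSemiLocalTower K v K₀ F ((u' : order K v F) : Alg K v F) := by
    funext w₀
    rw [← coe_unitsToSemiLocalTower_apply, ← coe_unitsToSemiLocalTower_apply, h]
  exact Units.ext (Subtype.ext ((toSemiLocalTower K v K₀ F).injective h'))

/-- **`x ∈ order ↔` every component of every block has valuation `≤ 1`** (`R = ⊕ 𝒪_𝔓`, grouped by `w₀`).
[cite: CasselsFrohlichANT1967, Ch. II §10 (10.2)] -/
theorem mem_order_iff_forall_tower (x : Alg K v F) :
    x ∈ order K v F ↔ ∀ (w₀ : v.Extension (𝓞 K₀)) (w : SemiLocal.Place K₀ F w₀.1),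
      Valued.v (toSemiLocalTower K v K₀ F x w₀ w) ≤ 1 := by
  rw [mem_order_iff_forall_mem_adicCompletionIntegers]
  constructor
  · intro h w₀ w
    exact h (extensionOfPlace K v K₀ F w₀ w)
  · intro h w
    exact h (placeUnder K v K₀ F w) (placeOver K v K₀ F w)

/-- **Each block lands in `∏_{w∣w₀} 𝒪_wˣ = SemiLocal.unitGroup K₀ F w₀`.** [cite: Harari2020, §13.1] -/
theorem unitsToSemiLocalTower_mem_unitGroup (u : (order K v F)ˣ) (w₀ : v.Extension (𝓞 K₀)) :
    unitsToSemiLocalTower K v K₀ F u w₀ ∈ SemiLocal.unitGroup K₀ F w₀.1 :=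
  SemiLocal.mem_unitGroup_of_valued_le_one
    (fun w ↦ (mem_order_iff_forall_tower K v K₀ F _).mp (u : order K v F).2 w₀ w)
    (fun w ↦ by
      rw [← Pi.inv_apply, ← map_inv]
      exact (mem_order_iff_forall_tower K v K₀ F _).mp ((u⁻¹ : (order K v F)ˣ) : order K v F).2 w₀ w)

/-- **Every family of blocks in `∏_{w₀} SemiLocal.unitGroup K₀ F w₀` is a local unit** (its components and its
inverse's are integral). [cite: Harari2020, §13.1] -/
theorem exists_unitsToSemiLocalTower_eq_of_forall_mem_unitGroup {y : Π w₀ : v.Extension (𝓞 K₀), (SemiLocal K₀ F w₀.1)ˣ}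
    (hy : ∀ w₀, y w₀ ∈ SemiLocal.unitGroup K₀ F w₀.1) :
    ∃ u : (order K v F)ˣ, unitsToSemiLocalTower K v K₀ F u = y := by
  set Y : Π w₀ : v.Extension (𝓞 K₀), SemiLocal K₀ F w₀.1 := fun w₀ ↦ (y w₀ : SemiLocal K₀ F w₀.1) with hY
  set Y' : Π w₀ : v.Extension (𝓞 K₀), SemiLocal K₀ F w₀.1 :=
    fun w₀ ↦ ((y w₀)⁻¹ : (SemiLocal K₀ F w₀.1)ˣ) with hY'
  have hYY' : Y * Y' = 1 := funext fun w₀ ↦ (y w₀).mul_inv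
  have hY'Y : Y' * Y = 1 := funext fun w₀ ↦ (y w₀).inv_mul
  have hx : (toSemiLocalTower K v K₀ F).symm Y ∈ order K v F := by
    rw [mem_order_iff_forall_tower K v K₀ F]
    intro w₀ w
    rw [RingEquiv.apply_symm_apply]
    exact (hy w₀ w).le
  have hx' : (toSemiLocalTower K v K₀ F).symm Y' ∈ order K v F := by
    rw [mem_order_iff_forall_tower K v K₀ F]
    intro w₀ w
    rw [RingEquiv.apply_symm_apply]
    exact ((SemiLocal.unitGroup K₀ F w₀.1).inv_mem (hy w₀) w).le
  refine ⟨⟨⟨_, hx⟩, ⟨_, hx'⟩, Subtype.ext ?_, Subtype.ext ?_⟩, ?_⟩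
  · change (toSemiLocalTower K v K₀ F).symm Y * (toSemiLocalTower K v K₀ F).symm Y' = 1
    rw [← map_mul, hYY', map_one]
  · change (toSemiLocalTower K v K₀ F).symm Y' * (toSemiLocalTower K v K₀ F).symm Y = 1
    rw [← map_mul, hY'Y, map_one]
  · funext w₀
    apply Units.ext
    rw [coe_unitsToSemiLocalTower_apply]
    change toSemiLocalTower K v K₀ F ((toSemiLocalTower K v K₀ F).symm Y) w₀ = Y w₀
    rw [RingEquiv.apply_symm_apply]

/-- **The Galois action over `K₀` on local units, block by block**: `unitsToSemiLocalTower ((1 ⊗ σ|_K) u) w₀ =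
σ • unitsToSemiLocalTower u w₀` in `(SemiLocal K₀ F w₀)ˣ`. [cite: Harari2020, §13.1] [cite: CasselsFrohlichANT1967, Ch. VII §1.1] -/
theorem unitsToSemiLocalTower_mapUnits (σ : F ≃ₐ[K₀] F) (u : (order K v F)ˣ) (w₀ : v.Extension (𝓞 K₀)) :
    unitsToSemiLocalTower K v K₀ F (mapUnits K v ((σ.restrictScalars K : F ≃ₐ[K] F) : F →ₐ[K] F) u) w₀ =
      σ • unitsToSemiLocalTower K v K₀ F u w₀ := by
  apply Units.ext
  rw [SemiLocal.val_smul_units, coe_unitsToSemiLocalTower_apply, coe_unitsToSemiLocalTower_apply,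
    ← toSemiLocalTower_map]
  rfl

/-- **Rubin's `U(F)` block by block**: `u ∈ principalUnits ↔` every component of every block satisfies
`v_w(u_w − 1) < 1`. [cite: CasselsFrohlichANT1967, Ch. II §10 (10.2)] -/
theorem mem_principalUnits_iff_tower (u : (order K v F)ˣ) :
    u ∈ principalUnits K v F ↔ ∀ (w₀ : v.Extension (𝓞 K₀)) (w : SemiLocal.Place K₀ F w₀.1),
      Valued.v (((unitsToSemiLocalTower K v K₀ F u w₀ : (SemiLocal K₀ F w₀.1)ˣ) : SemiLocal K₀ F w₀.1) w - 1) < 1 := by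
  rw [mem_principalUnits_iff_forall_valued_lt_one]
  constructor
  · intro h w₀ w
    exact h (extensionOfPlace K v K₀ F w₀ w)
  · intro h w
    exact h (placeUnder K v K₀ F w) (placeOver K v K₀ F w)

end Units

/-! ### §5. Subgroup form: `H ≤ Gal(F/K)` acting, base field `F^H` (the form in which `Gal(F_n/K₀)` is typed as
the subgroup of `Gal(F_n/K)` fixing `K₀`) -/

section Subgroup

variable (K : Type) [Field K] [NumberField K] (v : HeightOneSpectrum (𝓞 K))
  (F : Type) [Field F] [NumberField F] [Algebra K F] [FiniteDimensional K F] (H : Subgroup (F ≃ₐ[K] F))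

omit [NumberField K] [NumberField F] in
/-- Mathlib's `H ≃* Gal(F/F^H)` (`IntermediateField.subgroupEquivAlgEquiv`) followed by restriction of scalars to `K`
is the inclusion `H ≤ Gal(F/K)`. [cite: CasselsFrohlichANT1967, Ch. VII §1.1] -/
theorem restrictScalars_subgroupEquivAlgEquiv (σ : H) :
    ((IntermediateField.subgroupEquivAlgEquiv H σ).restrictScalars K : F ≃ₐ[K] F) = (σ : F ≃ₐ[K] F) :=
  AlgEquiv.ext fun _ ↦ rfl

omit [NumberField K] [NumberField F] in
/-- `σ ∈ H` moves the places of `F` as its avatar in `Gal(F/F^H)` does. [cite: CasselsFrohlichANT1967, Ch. VII §1.1] -/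
theorem subgroupEquivAlgEquiv_smul_place (σ : H) (w : HeightOneSpectrum (𝓞 F)) :
    (IntermediateField.subgroupEquivAlgEquiv H σ) • w = (σ : F ≃ₐ[K] F) • w := by
  rw [← restrictScalars_smul_place K (IntermediateField.fixedField H) F, restrictScalars_subgroupEquivAlgEquiv]

/-- **Subgroup form of the equivariance**: for `σ ∈ H ≤ Gal(F/K)` and `K₀ := F^H` (`IntermediateField.fixedField H`,
a number field — instance supplied by the consumer, e.g. `NumberField.of_module_finite K _`):
`toSemiLocalTower ((1 ⊗ σ) x) w₀ = σ′ • toSemiLocalTower x w₀` with `σ′ = subgroupEquivAlgEquiv H σ ∈ Gal(F/F^H)`.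
[cite: CasselsFrohlichANT1967, Ch. VII §1.1] -/
theorem toSemiLocalTower_map_subgroup [NumberField (IntermediateField.fixedField H)] (σ : H) (x : Alg K v F)
    (w₀ : v.Extension (𝓞 (IntermediateField.fixedField H))) :
    toSemiLocalTower K v (IntermediateField.fixedField H) F (map K v ((σ : F ≃ₐ[K] F) : F →ₐ[K] F) x) w₀ =
      (IntermediateField.subgroupEquivAlgEquiv H σ) • toSemiLocalTower K v (IntermediateField.fixedField H) F x w₀ := by
  rw [← toSemiLocalTower_map, restrictScalars_subgroupEquivAlgEquiv]

/-- **Subgroup form, stabilisers**: for `σ ∈ H` fixing the place `w ∣ w₀` (`w₀` a place of `F^H` over `v`), the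
`(w₀,w)`-component of `(1 ⊗ σ) x` is `SemiLocal.decompAlgEquiv w ⟨σ′, _⟩` — an `(F^H)_{w₀}`-automorphism of `F_w` — of the
component of `x`. [cite: CasselsFrohlichANT1967, Ch. VII §1.1] -/
theorem toSemiLocalTower_map_subgroup_apply_of_smul_eq [NumberField (IntermediateField.fixedField H)]
    (w₀ : v.Extension (𝓞 (IntermediateField.fixedField H)))
    (w : SemiLocal.Place (IntermediateField.fixedField H) F w₀.1) (σ : H)
    (hσ : (IntermediateField.subgroupEquivAlgEquiv H σ) • w = w) (x : Alg K v F) :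
    toSemiLocalTower K v (IntermediateField.fixedField H) F (map K v ((σ : F ≃ₐ[K] F) : F →ₐ[K] F) x) w₀ w =
      SemiLocal.decompAlgEquiv w ⟨IntermediateField.subgroupEquivAlgEquiv H σ, hσ⟩
        (toSemiLocalTower K v (IntermediateField.fixedField H) F x w₀ w) := by
  rw [← toSemiLocalTower_map_apply_of_mem_stabilizer, restrictScalars_subgroupEquivAlgEquiv]

/-- The stabiliser condition in `Gal(F/F^H)` is the stabiliser condition in `Gal(F/K)`: `σ′ • w = w ↔ σ • ↑w = ↑w`.
[cite: CasselsFrohlichANT1967, Ch. VII §1.1] -/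
theorem subgroupEquivAlgEquiv_smul_eq_iff [NumberField (IntermediateField.fixedField H)]
    (w₀ : v.Extension (𝓞 (IntermediateField.fixedField H)))
    (w : SemiLocal.Place (IntermediateField.fixedField H) F w₀.1) (σ : H) :
    (IntermediateField.subgroupEquivAlgEquiv H σ) • w = w ↔
      (σ : F ≃ₐ[K] F) • (w : HeightOneSpectrum (𝓞 F)) = w := by
  rw [← subgroupEquivAlgEquiv_smul_place K F H σ, SemiLocal.Place.ext_iff, SemiLocal.Place.coe_smul]

/-- **Subgroup form, `F/K` Galois** (so `F/F^H` is Galois, Mathlib `IsGalois.tower_top_intermediateField`): the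
`(w₀,w)`-component of `(1 ⊗ σ) x`, `σ ∈ H` fixing `w`, is `SemiLocal.decompMulEquiv w ⟨σ′, _⟩` of the component —
`Stab(w) ≃* Gal(F_w/(F^H)_{w₀})`, the local Galois group over the completion of the FIXED FIELD, i.e. FILE B's `D` with
`L₀ = (F^H)_{w₀}`. [cite: CasselsFrohlichANT1967, Ch. VII §1.1] -/
theorem toSemiLocalTower_map_subgroup_apply_eq_decompMulEquiv [IsGalois K F] [NumberField (IntermediateField.fixedField H)]
    (w₀ : v.Extension (𝓞 (IntermediateField.fixedField H)))
    (w : SemiLocal.Place (IntermediateField.fixedField H) F w₀.1) (σ : H)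
    (hσ : (IntermediateField.subgroupEquivAlgEquiv H σ) • w = w) (x : Alg K v F) :
    toSemiLocalTower K v (IntermediateField.fixedField H) F (map K v ((σ : F ≃ₐ[K] F) : F →ₐ[K] F) x) w₀ w =
      SemiLocal.decompMulEquiv w ⟨IntermediateField.subgroupEquivAlgEquiv H σ, hσ⟩
        (toSemiLocalTower K v (IntermediateField.fixedField H) F x w₀ w) := by
  rw [SemiLocal.decompMulEquiv_apply, toSemiLocalTower_map_subgroup_apply_of_smul_eq]

set_option synthInstance.maxHeartbeats 100000 in
-- the action of `Gal(F/F^H)` on `(SemiLocal F^H F w₀)ˣ` is found slowly through the subtype field `↥(fixedField H)`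
/-- Units, subgroup form: `unitsToSemiLocalTower ((1 ⊗ σ) u) w₀ = σ′ • unitsToSemiLocalTower u w₀` for `σ ∈ H`.
[cite: Harari2020, §13.1] -/
theorem unitsToSemiLocalTower_mapUnits_subgroup [NumberField (IntermediateField.fixedField H)] (σ : H)
    (u : (order K v F)ˣ) (w₀ : v.Extension (𝓞 (IntermediateField.fixedField H))) :
    unitsToSemiLocalTower K v (IntermediateField.fixedField H) F (mapUnits K v ((σ : F ≃ₐ[K] F) : F →ₐ[K] F) u) w₀ =
      (IntermediateField.subgroupEquivAlgEquiv H σ) • unitsToSemiLocalTower K v (IntermediateField.fixedField H) F u w₀ := by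
  rw [← unitsToSemiLocalTower_mapUnits, restrictScalars_subgroupEquivAlgEquiv]

end Subgroup

/-! ### §6. Intermediate-field form: base `K₀ : IntermediateField K F`, the group `K₀.fixingSubgroup ≤ Gal(F/K)` -/

section Intermediate

variable (K : Type) [Field K] [NumberField K] (v : HeightOneSpectrum (𝓞 K))
  (F : Type) [Field F] [NumberField F] [Algebra K F] [FiniteDimensional K F] (K₀ : IntermediateField K F)

omit [NumberField K] [NumberField F] [FiniteDimensional K F] in
/-- Mathlib's `K₀.fixingSubgroup ≃* Gal(F/K₀)` (`IntermediateField.fixingSubgroupEquiv`) followed by restriction of scalars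
to `K` is the inclusion `K₀.fixingSubgroup ≤ Gal(F/K)`. [cite: CasselsFrohlichANT1967, Ch. VII §1.1] -/
theorem restrictScalars_fixingSubgroupEquiv (σ : K₀.fixingSubgroup) :
    ((IntermediateField.fixingSubgroupEquiv K₀ σ).restrictScalars K : F ≃ₐ[K] F) = (σ : F ≃ₐ[K] F) :=
  AlgEquiv.ext fun _ ↦ rfl

omit [NumberField K] [NumberField F] [FiniteDimensional K F] in
/-- `σ ∈ K₀.fixingSubgroup` moves the places of `F` as its avatar in `Gal(F/K₀)` does. [cite: CasselsFrohlichANT1967, Ch. VII §1.1] -/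
theorem fixingSubgroupEquiv_smul_place (σ : K₀.fixingSubgroup) (w : HeightOneSpectrum (𝓞 F)) :
    (IntermediateField.fixingSubgroupEquiv K₀ σ) • w = (σ : F ≃ₐ[K] F) • w := by
  rw [← restrictScalars_smul_place K K₀ F, restrictScalars_fixingSubgroupEquiv]

/-- **Intermediate-field form of the equivariance**: for `σ ∈ K₀.fixingSubgroup` (`K₀ : IntermediateField K F`, a number
field — instance supplied by the consumer, e.g. `NumberField.of_module_finite K _`):
`toSemiLocalTower ((1 ⊗ σ) x) w₀ = σ′ • toSemiLocalTower x w₀`, `σ′ = fixingSubgroupEquiv K₀ σ ∈ Gal(F/K₀)`.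
[cite: CasselsFrohlichANT1967, Ch. VII §1.1] -/
theorem toSemiLocalTower_map_fixingSubgroup [NumberField K₀] (σ : K₀.fixingSubgroup) (x : Alg K v F)
    (w₀ : v.Extension (𝓞 K₀)) :
    toSemiLocalTower K v K₀ F (map K v ((σ : F ≃ₐ[K] F) : F →ₐ[K] F) x) w₀ =
      (IntermediateField.fixingSubgroupEquiv K₀ σ) • toSemiLocalTower K v K₀ F x w₀ := by
  rw [← toSemiLocalTower_map, restrictScalars_fixingSubgroupEquiv]

omit [FiniteDimensional K F] in
/-- The stabiliser condition in `Gal(F/K₀)` is the stabiliser condition in `Gal(F/K)`. [cite: CasselsFrohlichANT1967, Ch. VII §1.1] -/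
theorem fixingSubgroupEquiv_smul_eq_iff [NumberField K₀] (w₀ : v.Extension (𝓞 K₀)) (w : SemiLocal.Place K₀ F w₀.1)
    (σ : K₀.fixingSubgroup) :
    (IntermediateField.fixingSubgroupEquiv K₀ σ) • w = w ↔ (σ : F ≃ₐ[K] F) • (w : HeightOneSpectrum (𝓞 F)) = w := by
  rw [← fixingSubgroupEquiv_smul_place K F K₀ σ, SemiLocal.Place.ext_iff, SemiLocal.Place.coe_smul]

/-- **Intermediate-field form, stabilisers**: for `σ ∈ K₀.fixingSubgroup` fixing the place `w ∣ w₀` of `F`, the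
`(w₀,w)`-component of `(1 ⊗ σ) x` is `SemiLocal.decompAlgEquiv w ⟨σ′, _⟩ ∈ Aut(F_w/(K₀)_{w₀})` of the component of `x`.
[cite: CasselsFrohlichANT1967, Ch. VII §1.1] -/
theorem toSemiLocalTower_map_fixingSubgroup_apply_of_smul_eq [NumberField K₀] (w₀ : v.Extension (𝓞 K₀))
    (w : SemiLocal.Place K₀ F w₀.1) (σ : K₀.fixingSubgroup)
    (hσ : (IntermediateField.fixingSubgroupEquiv K₀ σ) • w = w) (x : Alg K v F) :
    toSemiLocalTower K v K₀ F (map K v ((σ : F ≃ₐ[K] F) : F →ₐ[K] F) x) w₀ w =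
      SemiLocal.decompAlgEquiv w ⟨IntermediateField.fixingSubgroupEquiv K₀ σ, hσ⟩ (toSemiLocalTower K v K₀ F x w₀ w) := by
  rw [← toSemiLocalTower_map_apply_of_mem_stabilizer, restrictScalars_fixingSubgroupEquiv]

/-- **Intermediate-field form, `F/K` Galois** (`F/K₀` Galois by Mathlib `IsGalois.tower_top_intermediateField`): the
`(w₀,w)`-component of `(1 ⊗ σ) x`, `σ ∈ K₀.fixingSubgroup` fixing `w`, is `SemiLocal.decompMulEquiv w ⟨σ′, _⟩` of the component —
`Stab(w) ≃* Gal(F_w/(K₀)_{w₀})`, FILE B's `D` with `L₀ = (K₀)_{w₀}`. [cite: CasselsFrohlichANT1967, Ch. VII §1.1] -/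
theorem toSemiLocalTower_map_fixingSubgroup_apply_eq_decompMulEquiv [IsGalois K F] [NumberField K₀]
    (w₀ : v.Extension (𝓞 K₀)) (w : SemiLocal.Place K₀ F w₀.1) (σ : K₀.fixingSubgroup)
    (hσ : (IntermediateField.fixingSubgroupEquiv K₀ σ) • w = w) (x : Alg K v F) :
    toSemiLocalTower K v K₀ F (map K v ((σ : F ≃ₐ[K] F) : F →ₐ[K] F) x) w₀ w =
      SemiLocal.decompMulEquiv w ⟨IntermediateField.fixingSubgroupEquiv K₀ σ, hσ⟩ (toSemiLocalTower K v K₀ F x w₀ w) := by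
  rw [SemiLocal.decompMulEquiv_apply, toSemiLocalTower_map_fixingSubgroup_apply_of_smul_eq]

set_option synthInstance.maxHeartbeats 100000 in
-- the action of `Gal(F/K₀)` on `(SemiLocal K₀ F w₀)ˣ` is found slowly through the subtype field `↥K₀`
/-- Units, intermediate-field form: `unitsToSemiLocalTower ((1 ⊗ σ) u) w₀ = σ′ • unitsToSemiLocalTower u w₀` for
`σ ∈ K₀.fixingSubgroup`. [cite: Harari2020, §13.1] -/
theorem unitsToSemiLocalTower_mapUnits_fixingSubgroup [NumberField K₀] (σ : K₀.fixingSubgroup) (u : (order K v F)ˣ)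
    (w₀ : v.Extension (𝓞 K₀)) :
    unitsToSemiLocalTower K v K₀ F (mapUnits K v ((σ : F ≃ₐ[K] F) : F →ₐ[K] F) u) w₀ =
      (IntermediateField.fixingSubgroupEquiv K₀ σ) • unitsToSemiLocalTower K v K₀ F u w₀ := by
  rw [← unitsToSemiLocalTower_mapUnits, restrictScalars_fixingSubgroupEquiv]

end Intermediate

end Literature.NumberTheory.NumberFields.Semilocal
end
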